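import Summits.SmoothPoincare4.SmoothPoincare4.Theorems.CongruenceShadowsShadowsStandardHelperHallLemma
import Summits.SmoothPoincare4.SmoothPoincare4.Theorems.CongruenceShadowsShadowsStandardHelperHallCoordinates
import Literature.GroupTheory.SpecificGroups.NormalSubgroupsPiSimple
import HarnessLib

/-!
# The K-free gate at a maximal characteristic level from monodromy — helper `helper_gateOfMonodromy` of
line `prym-layer-stable-rank` for crux `CongruenceShadows.ShadowsStandard` (item stmt-SmoothPoincare4-14593,
route route-SmoothPoincare4-CongruenceShadows)

**Hall coordinates.** Let `M` be a maximal characteristic finite-index subgroup of a group `G` with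
non-abelian quotient and `𝓟` the (finite, `Aut G`-stable) set of maximal normal overgroups of `M`. By
`helper_maxCharLevel` (p125346) the `P ∈ 𝓟` meet in `M` and have non-abelian simple quotients; the
diagonal map `j : G → ∏_{P ∈ 𝓟} G/P` is pairwise surjective (Chinese remainder for two distinct maximal
normal subgroups), hence surjective by Hall's lemma (`helper_hallLemma`, p125337), with kernel `M`:
`G/M ≅ ∏_{P ∈ 𝓟} G/P`. Consequently (`Literature.GroupTheory.SpecificGroups.exists_eq_pi_of_normal`)
every normal overgroup `X` of `M` is cut out by `A(X) = {P ∈ 𝓟 | X ≤ P}`, automorphisms act on `𝓟` by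
permutations — TRANSITIVELY (the intersection of an orbit is characteristic and proper, hence `M`, and a
non-trivial coordinate supported off the orbit contradicts this) — and for two covering triples `X`, `Y`
of normal overgroups that are pairwise `Aut G`-equivalent the Venn cells of `(A(Xᵢ))` and `(A(Yᵢ))` agree
(triple cells empty by covering). **The gate** (`gate_of_monodromy`, registered `∀`-form
`helper_gateOfMonodromy`): if EITHER `|𝓟| ≥ 8` and every 3-cycle of `𝓟` is realised by an automorphism
(alternating monodromy: `helper_vennEvenPerm` p125485 gives an even `σ`, realised via
`alternatingGroup_le_of_threeCycles_realised`) OR `|𝓟| ≤ 2` (every permutation realised by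
transitivity, `eq_top_of_card_le_two_of_transitive`, plain `vennPerm`), then `X` and `Y` are
simultaneously `Aut G`-equivalent. The file declares theorems only.
-/

set_option linter.dupNamespace false

noncomputable section

namespace Summit.SmoothPoincare4.SmoothPoincare4.Theorems.ShadowsStandard.PrymLayerStableRank

open Subgroup

section General

variable {G : Type} [Group G]

/-- **The K-free gate at a maximal characteristic level from monodromy** (general group form).
Let `M` be characteristic of finite index in `G`, maximal among characteristic subgroups, with
non-abelian quotient, and let `𝓟` be the (finite) set of maximal normal overgroups of `M`. Suppose
EITHER `𝓟` has at least `8` elements and every 3-cycle of `𝓟` is realised by an automorphism of `G`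
(alternating monodromy with parity room) OR `𝓟` has at most `2` elements. Then any two COVERING triples
`X`, `Y` of normal overgroups of `M` that are PAIRWISE `Aut G`-equivalent are simultaneously
`Aut G`-equivalent. Ingredients: Hall's lemma (`helper_hallLemma`, Hall coordinates
`G/M ≅ ∏_{P ∈ 𝓟} G/P`), the level structure (`helper_maxCharLevel`), normal subgroups of products of
non-abelian simple groups (`exists_eq_pi_of_normal`), the Venn lemmas, `closure_three_cycles_eq_alternating`,
and transitivity of `Aut G` on `𝓟` (the intersection of an orbit is characteristic). [folklore] -/
theorem gate_of_monodromy (M : Subgroup G) (hM : M.Characteristic) (hMf : M.FiniteIndex)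
    (hmaxc : ∀ X : Subgroup G, X.Characteristic → M < X → X = ⊤)
    (hnonab : ¬ ⁅(⊤ : Subgroup G), (⊤ : Subgroup G)⁆ ≤ M)
    (hmono : (8 ≤ {P : Subgroup G | P.Normal ∧ M ≤ P ∧ P ≠ ⊤ ∧
        ∀ Q : Subgroup G, Q.Normal → P ≤ Q → Q = P ∨ Q = ⊤}.ncard ∧
      ∀ P₁ P₂ P₃ : Subgroup G,
        (P₁.Normal ∧ M ≤ P₁ ∧ P₁ ≠ ⊤ ∧ ∀ Q : Subgroup G, Q.Normal → P₁ ≤ Q → Q = P₁ ∨ Q = ⊤) →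
        (P₂.Normal ∧ M ≤ P₂ ∧ P₂ ≠ ⊤ ∧ ∀ Q : Subgroup G, Q.Normal → P₂ ≤ Q → Q = P₂ ∨ Q = ⊤) →
        (P₃.Normal ∧ M ≤ P₃ ∧ P₃ ≠ ⊤ ∧ ∀ Q : Subgroup G, Q.Normal → P₃ ≤ Q → Q = P₃ ∨ Q = ⊤) →
        P₁ ≠ P₂ → P₂ ≠ P₃ → P₁ ≠ P₃ →
        ∃ ψ : G ≃* G, P₁.map ψ.toMonoidHom = P₂ ∧ P₂.map ψ.toMonoidHom = P₃ ∧
          P₃.map ψ.toMonoidHom = P₁ ∧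
          ∀ P : Subgroup G,
            (P.Normal ∧ M ≤ P ∧ P ≠ ⊤ ∧ ∀ Q : Subgroup G, Q.Normal → P ≤ Q → Q = P ∨ Q = ⊤) →
            P ≠ P₁ → P ≠ P₂ → P ≠ P₃ → P.map ψ.toMonoidHom = P) ∨
      {P : Subgroup G | P.Normal ∧ M ≤ P ∧ P ≠ ⊤ ∧
        ∀ Q : Subgroup G, Q.Normal → P ≤ Q → Q = P ∨ Q = ⊤}.ncard ≤ 2)
    (X Y : Fin 3 → Subgroup G) (hXn : ∀ i, (X i).Normal) (hYn : ∀ i, (Y i).Normal)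
    (hMX : ∀ i, M ≤ X i) (hMY : ∀ i, M ≤ Y i)
    (hpair : ∀ i j : Fin 3, i ≠ j → ∃ α : G ≃* G,
      (X i).map α.toMonoidHom = Y i ∧ (X j).map α.toMonoidHom = Y j)
    (hXcov : X 0 ⊔ X 1 ⊔ X 2 = ⊤) (hYcov : Y 0 ⊔ Y 1 ⊔ Y 2 = ⊤) :
    ∃ ψ : G ≃* G, ∀ i : Fin 3, (X i).map ψ.toMonoidHom = Y i := by
  classical
  haveI : M.Characteristic := hM
  haveI : M.FiniteIndex := hMf
  obtain ⟨hnonabP, hinter⟩ := helper_maxCharLevel G M hM hMf hmaxc hnonab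
  -- the index set of maximal normal overgroups of `M`
  set 𝓢 : Set (Subgroup G) := {P : Subgroup G | P.Normal ∧ M ≤ P ∧ P ≠ ⊤ ∧
      ∀ Q : Subgroup G, Q.Normal → P ≤ Q → Q = P ∨ Q = ⊤} with h𝓢
  have hfin : 𝓢.Finite := (finite_setOf_normal_finiteIndex_le M).subset fun P hP => hP.2.1
  letI : Fintype 𝓢 := hfin.fintype
  haveI hPn : ∀ P : 𝓢, (P.1).Normal := fun P => P.2.1
  haveI hsimple : ∀ P : 𝓢, IsSimpleGroup (G ⧸ P.1) := fun P =>
    isSimpleGroup_quotient_of_maximal_normal P.1 P.2.2.2.1 P.2.2.2.2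
  have hnc : ∀ P : 𝓢, ¬ IsMulCommutative (G ⧸ P.1) := fun P =>
    not_isMulCommutative_quotient P.1 (hnonabP P.1 P.2.1 P.2.2.1 P.2.2.2.1 P.2.2.2.2)
  have hcardS : Fintype.card 𝓢 = 𝓢.ncard := by
    rw [Fintype.card_eq_nat_card, Nat.card_coe_set_eq]
  -- the diagonal map `j : G → ∏ G/P`
  let j : G →* ((P : 𝓢) → G ⧸ P.1) := MonoidHom.pi fun P => QuotientGroup.mk' P.1
  have hj_apply : ∀ (g : G) (P : 𝓢), j g P = QuotientGroup.mk' P.1 g := fun g P => rfl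
  have hj_one : ∀ (g : G) (P : 𝓢), j g P = 1 ↔ g ∈ P.1 := fun g P => by
    rw [hj_apply, QuotientGroup.mk'_apply, QuotientGroup.eq_one_iff]
  -- pairwise surjectivity (Chinese remainder)
  have hpair_surj : ∀ P P' : 𝓢, P ≠ P' → ∀ (x : G ⧸ P.1) (y : G ⧸ P'.1),
      ∃ h : (P : 𝓢) → G ⧸ P.1, h ∈ j.range ∧ h P = x ∧ h P' = y := by
    intro P P' hPP' x y
    obtain ⟨a, rfl⟩ := QuotientGroup.mk'_surjective P.1 x
    obtain ⟨b, rfl⟩ := QuotientGroup.mk'_surjective P'.1 y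
    have hsup : P.1 ⊔ P'.1 = ⊤ := by
      rcases P.2.2.2.2 (P.1 ⊔ P'.1) inferInstance le_sup_left with h | h
      · exfalso
        have hle : P'.1 ≤ P.1 := by rw [← h]; exact le_sup_right
        rcases P'.2.2.2.2 P.1 P.2.1 hle with h' | h'
        · exact hPP' (Subtype.ext h')
        · exact P.2.2.2.1 h'
      · exact h
    obtain ⟨g, hg1, hg2⟩ := exists_mk_eq_mk_eq P.1 P'.1 hsup a b
    exact ⟨j g, ⟨g, rfl⟩, hg1, hg2⟩
  have hsingle_surj : ∀ (P : 𝓢) (x : G ⧸ P.1),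
      ∃ h : (P : 𝓢) → G ⧸ P.1, h ∈ j.range ∧ h P = x := by
    intro P x
    obtain ⟨a, rfl⟩ := QuotientGroup.mk'_surjective P.1 x
    exact ⟨j a, ⟨a, rfl⟩, rfl⟩
  have hrange : j.range = ⊤ :=
    helper_hallLemma 𝓢 (fun P => G ⧸ P.1) hnc j.range hpair_surj hsingle_surj
  have hjsurj : Function.Surjective j := MonoidHom.range_eq_top.1 hrange
  -- kernel of `j` is `M`
  have hker : j.ker = M := by
    ext x
    constructor
    · intro hx
      apply hinter x
      intro P hP1 hP2 hP3 hP4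
      have := congrFun (MonoidHom.mem_ker.1 hx) ⟨P, hP1, hP2, hP3, hP4⟩
      rwa [Pi.one_apply, hj_one] at this
    · intro hx
      rw [MonoidHom.mem_ker]
      funext P
      rw [Pi.one_apply, hj_one]
      exact P.2.2.1 hx
  -- a normal overgroup of `M` is cut out by the maximal normal overgroups containing it
  have hdet : ∀ X' : Subgroup G, X'.Normal → M ≤ X' → ∀ x : G,
      (∀ P : 𝓢, X' ≤ P.1 → x ∈ P.1) → x ∈ X' := by
    intro X' hX'n hMX' x hx
    haveI := hX'n
    haveI : (X'.map j).Normal := Subgroup.Normal.map hX'n j hjsurj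
    obtain ⟨I, hI⟩ := Literature.GroupTheory.SpecificGroups.exists_eq_pi_of_normal hnc (X'.map j)
    have hXP : ∀ P : 𝓢, P ∉ I → X' ≤ P.1 := by
      intro P hP x' hx'
      have hm : j x' ∈ X'.map j := ⟨x', hx', rfl⟩
      rw [hI, Subgroup.mem_pi] at hm
      have := hm P hP
      rwa [Subgroup.mem_bot, hj_one] at this
    have hjx : j x ∈ X'.map j := by
      rw [hI, Subgroup.mem_pi]
      intro P hP
      rw [Subgroup.mem_bot, hj_one]
      exact hx P (hXP P hP)
    have hkerle : j.ker ≤ X' := by rw [hker]; exact hMX'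
    have hx' : x ∈ (X'.map j).comap j := hjx
    rwa [Subgroup.comap_map_eq_self hkerle] at hx'
  -- the action of automorphisms on the index set
  let act : (G ≃* G) → 𝓢 → 𝓢 := fun φ P => ⟨P.1.map φ.toMonoidHom, maxNormal_map M hM φ P.2⟩
  have act_val : ∀ (φ : G ≃* G) (P : 𝓢), (act φ P).1 = P.1.map φ.toMonoidHom := fun _ _ => rfl
  have act_trans : ∀ (φ ψ : G ≃* G) (P : 𝓢), act (φ.trans ψ) P = act ψ (act φ P) := by
    intro φ ψ P
    apply Subtype.ext
    simp only [act_val, Subgroup.map_map]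
    rfl
  have act_refl : ∀ P : 𝓢, act (MulEquiv.refl G) P = P := by
    intro P
    apply Subtype.ext
    simp only [act_val]
    ext x
    simp
  have act_symm_self : ∀ (φ : G ≃* G) (P : 𝓢), act φ.symm (act φ P) = P := by
    intro φ P; rw [← act_trans, MulEquiv.self_trans_symm, act_refl]
  have act_self_symm : ∀ (φ : G ≃* G) (P : 𝓢), act φ (act φ.symm P) = P := by
    intro φ P; rw [← act_trans, MulEquiv.symm_trans_self, act_refl]
  let actPerm : (G ≃* G) → Equiv.Perm 𝓢 := fun φ =>
    { toFun := act φ, invFun := act φ.symm,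
      left_inv := fun P => act_symm_self φ P, right_inv := fun P => act_self_symm φ P }
  have actPerm_apply : ∀ (φ : G ≃* G) (P : 𝓢), actPerm φ P = act φ P := fun _ _ => rfl
  -- realised permutations: a subgroup of `Perm 𝓢`
  let R : Subgroup (Equiv.Perm 𝓢) :=
    { carrier := {σ | ∃ φ : G ≃* G, ∀ P, σ P = act φ P}
      one_mem' := ⟨MulEquiv.refl G, fun P => (act_refl P).symm⟩
      mul_mem' := by
        rintro σ τ ⟨φ, hφ⟩ ⟨ψ, hψ⟩
        refine ⟨ψ.trans φ, fun P => ?_⟩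
        rw [Equiv.Perm.mul_apply, hψ, hφ, act_trans]
      inv_mem' := by
        rintro σ ⟨φ, hφ⟩
        refine ⟨φ.symm, fun P => ?_⟩
        rw [Equiv.Perm.inv_def, Equiv.symm_apply_eq, hφ, act_self_symm] }
  have hR_mem : ∀ σ : Equiv.Perm 𝓢, σ ∈ R ↔ ∃ φ : G ≃* G, ∀ P, σ P = act φ P := fun σ => Iff.rfl
  -- transitivity of the action: the intersection of an orbit is characteristic, hence `M`
  have htrans : ∀ P P' : 𝓢, ∃ φ : G ≃* G, act φ P = P' := by
    intro P P'
    by_contra hne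
    push Not at hne
    let good : Subgroup G → Prop := fun Q => ∃ φ : G ≃* G, Q = (act φ P).1
    have hstab : ∀ (φ : G ≃* G) (Q : Subgroup G), good Q → good (Q.comap φ.toMonoidHom) := by
      rintro φ Q ⟨ψ, rfl⟩
      refine ⟨ψ.trans φ.symm, ?_⟩
      rw [act_trans]
      show (act ψ P).1.comap φ.toMonoidHom = ((act ψ P).1).map φ.symm.toMonoidHom
      rw [Subgroup.map_equiv_eq_comap_symm', MulEquiv.symm_symm]
    have hle : ∀ Q, good Q → M ≤ Q := by
      rintro Q ⟨ψ, rfl⟩; exact (act ψ P).2.2.1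
    rcases iInf₂_eq_or_eq_top_of_maxChar hmaxc hstab hle with h | h
    · obtain ⟨t, ht⟩ : ∃ t : G ⧸ P'.1, t ≠ 1 := exists_ne 1
      obtain ⟨x, hx⟩ := hjsurj (Pi.mulSingle P' t)
      have hxQ : ∀ Q, good Q → x ∈ Q := by
        rintro Q ⟨ψ, rfl⟩
        rw [← hj_one, hx, Pi.mulSingle_eq_of_ne (hne ψ)]
      have hxM : x ∈ M := by
        rw [← h]
        exact Subgroup.mem_iInf.2 fun Q => Subgroup.mem_iInf.2 fun hQ => hxQ Q hQ
      have hxP' : x ∈ P'.1 := P'.2.2.1 hxM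
      rw [← hj_one, hx, Pi.mulSingle_eq_same] at hxP'
      exact ht hxP'
    · have hleP : (⨅ (Q : Subgroup G) (_ : good Q), Q) ≤ P.1 :=
        iInf₂_le P.1 ⟨MulEquiv.refl G, by rw [act_refl]⟩
      rw [h] at hleP
      exact P.2.2.2.1 (top_le_iff.1 hleP)
  -- Venn data
  let A : Fin 3 → Finset 𝓢 := fun i => Finset.univ.filter fun P => X i ≤ P.1
  let B : Fin 3 → Finset 𝓢 := fun i => Finset.univ.filter fun P => Y i ≤ P.1
  have hmemA : ∀ i P, P ∈ A i ↔ X i ≤ P.1 := by intro i P; simp [A]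
  have hmemB : ∀ i P, P ∈ B i ↔ Y i ≤ P.1 := by intro i P; simp [B]
  have himage : ∀ (α : G ≃* G) (X' Y' : Subgroup G), X'.map α.toMonoidHom = Y' →
      (Finset.univ.filter fun P : 𝓢 => X' ≤ P.1).image (actPerm α) =
        Finset.univ.filter fun P : 𝓢 => Y' ≤ P.1 := by
    intro α X' Y' hXY
    ext P
    simp only [Finset.mem_image, Finset.mem_filter, Finset.mem_univ, true_and]
    constructor
    · rintro ⟨P', hP', rfl⟩
      rw [actPerm_apply, act_val, ← hXY]
      exact Subgroup.map_mono hP'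
    · intro hP
      refine ⟨act α.symm P, ?_, ?_⟩
      · rw [act_val]
        have e : X' = Y'.map α.symm.toMonoidHom := by
          rw [← hXY, Subgroup.map_map]
          ext x; simp
        rw [e]
        exact Subgroup.map_mono hP
      · rw [actPerm_apply, act_self_symm]
  have hAB : ∀ (α : G ≃* G) (i : Fin 3), (X i).map α.toMonoidHom = Y i →
      (A i).image (actPerm α) = B i := fun α i h => himage α (X i) (Y i) h
  have himage_inter : ∀ (α : G ≃* G) (i k : Fin 3), (X i).map α.toMonoidHom = Y i →
      (X k).map α.toMonoidHom = Y k → (A i ∩ A k).image (actPerm α) = B i ∩ B k := by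
    intro α i k hi hk
    rw [Finset.image_inter _ _ (actPerm α).injective, hAB α i hi, hAB α k hk]
  have hcardA : ∀ i, (A i).card = (B i).card := by
    intro i
    obtain ⟨k, hk⟩ : ∃ k : Fin 3, i ≠ k := ⟨i + 1, by fin_cases i <;> decide⟩
    obtain ⟨α, hα, -⟩ := hpair i k hk
    rw [← hAB α i hα, Finset.card_image_of_injective _ (actPerm α).injective]
  have hcardAB : ∀ i k, (A i ∩ A k).card = (B i ∩ B k).card := by
    intro i k
    by_cases hik : i = k
    · subst hik; simpa using hcardA i
    · obtain ⟨α, hαi, hαk⟩ := hpair i k hik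
      rw [← himage_inter α i k hαi hαk, Finset.card_image_of_injective _ (actPerm α).injective]
  have hAempty : A 0 ∩ A 1 ∩ A 2 = ∅ := by
    rw [Finset.eq_empty_iff_forall_notMem]
    intro P hP
    simp only [Finset.mem_inter, hmemA] at hP
    apply P.2.2.2.1
    rw [eq_top_iff, ← hXcov]
    exact sup_le (sup_le hP.1.1 hP.1.2) hP.2
  have hBempty : B 0 ∩ B 1 ∩ B 2 = ∅ := by
    rw [Finset.eq_empty_iff_forall_notMem]
    intro P hP
    simp only [Finset.mem_inter, hmemB] at hP
    apply P.2.2.2.1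
    rw [eq_top_iff, ← hYcov]
    exact sup_le (sup_le hP.1.1 hP.1.2) hP.2
  -- a realised permutation carrying `A` to `B` finishes the proof
  have key : ∀ σ : Equiv.Perm 𝓢, σ ∈ R → (∀ i, (A i).image σ = B i) →
      ∃ ψ : G ≃* G, ∀ i : Fin 3, (X i).map ψ.toMonoidHom = Y i := by
    intro σ hσR hσ
    obtain ⟨φ, hφ⟩ := (hR_mem σ).1 hσR
    refine ⟨φ, fun i => ?_⟩
    haveI := hXn i
    haveI := hYn i
    ext x
    constructor
    · intro hx
      apply hdet (Y i) (hYn i) (hMY i) x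
      intro P hP
      have hPB : P ∈ B i := (hmemB i P).2 hP
      rw [← hσ i, Finset.mem_image] at hPB
      obtain ⟨P', hP', hP'P⟩ := hPB
      rw [hφ P'] at hP'P
      have : (X i).map φ.toMonoidHom ≤ P.1 := by
        rw [← hP'P, act_val]
        exact Subgroup.map_mono ((hmemA i P').1 hP')
      exact this hx
    · intro hx
      rw [Subgroup.mem_map_equiv]
      apply hdet (X i) (hXn i) (hMX i) (φ.symm x)
      intro P' hP'
      have hmem : σ P' ∈ B i := by
        rw [← hσ i]
        exact Finset.mem_image_of_mem σ ((hmemA i P').2 hP')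
      rw [hmemB, hφ P', act_val] at hmem
      have hx' : x ∈ P'.1.map φ.toMonoidHom := hmem hx
      rwa [Subgroup.mem_map_equiv] at hx'
  rcases hmono with ⟨h8, h3⟩ | h2
  · -- alternating monodromy with parity room: every 3-cycle of `𝓢` is realised
    have hAltR : alternatingGroup 𝓢 ≤ R := by
      refine alternatingGroup_le_of_threeCycles_realised R fun a b c hab hbc hac => ?_
      obtain ⟨φ, h1, h2, h3', hfix⟩ := h3 a.1 b.1 c.1 a.2 b.2 c.2
        (fun h => hab (Subtype.ext h)) (fun h => hbc (Subtype.ext h)) (fun h => hac (Subtype.ext h))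
      refine ⟨actPerm φ, (hR_mem _).2 ⟨φ, fun P => rfl⟩, Subtype.ext (by rw [actPerm_apply, act_val, h1]),
        Subtype.ext (by rw [actPerm_apply, act_val, h2]), Subtype.ext (by rw [actPerm_apply, act_val, h3']),
        fun P hPa hPb hPc => Subtype.ext ?_⟩
      rw [actPerm_apply, act_val]
      exact hfix P.1 P.2 (fun h => hPa (Subtype.ext h)) (fun h => hPb (Subtype.ext h))
        (fun h => hPc (Subtype.ext h))
    have hcard8 : 8 ≤ Fintype.card 𝓢 := by rw [hcardS]; exact h8
    obtain ⟨σ, hσA, hσ⟩ := helper_vennEvenPerm 𝓢 A B hcardA hcardAB hAempty hBempty hcard8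
    exact key σ (hAltR hσA) hσ
  · -- tiny index set: every permutation is realised (transitivity on ≤ 2 points)
    have hcard2 : Fintype.card 𝓢 ≤ 2 := by rw [hcardS]; exact h2
    have hRtop : R = ⊤ :=
      eq_top_of_card_le_two_of_transitive R hcard2 fun a b => by
        obtain ⟨φ, hφ⟩ := htrans a b
        exact ⟨actPerm φ, (hR_mem _).2 ⟨φ, fun P => rfl⟩, hφ⟩
    obtain ⟨σ, hσ⟩ := vennPerm A B hcardA hcardAB hAempty hBempty
    exact key σ (hRtop ▸ Subgroup.mem_top σ) hσ

end General

/-- **REGISTERED HELPER `helper_gateOfMonodromy`** (`∀ G`-form of `gate_of_monodromy`). [folklore] -/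
theorem helper_gateOfMonodromy :
    ∀ (G : Type) [Group G] (M : Subgroup G), M.Characteristic → M.FiniteIndex →
      (∀ X : Subgroup G, X.Characteristic → M < X → X = ⊤) →
      ¬ ⁅(⊤ : Subgroup G), (⊤ : Subgroup G)⁆ ≤ M →
      ((8 ≤ {P : Subgroup G | P.Normal ∧ M ≤ P ∧ P ≠ ⊤ ∧
          ∀ Q : Subgroup G, Q.Normal → P ≤ Q → Q = P ∨ Q = ⊤}.ncard ∧
        ∀ P₁ P₂ P₃ : Subgroup G,
          (P₁.Normal ∧ M ≤ P₁ ∧ P₁ ≠ ⊤ ∧ ∀ Q : Subgroup G, Q.Normal → P₁ ≤ Q → Q = P₁ ∨ Q = ⊤) →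
          (P₂.Normal ∧ M ≤ P₂ ∧ P₂ ≠ ⊤ ∧ ∀ Q : Subgroup G, Q.Normal → P₂ ≤ Q → Q = P₂ ∨ Q = ⊤) →
          (P₃.Normal ∧ M ≤ P₃ ∧ P₃ ≠ ⊤ ∧ ∀ Q : Subgroup G, Q.Normal → P₃ ≤ Q → Q = P₃ ∨ Q = ⊤) →
          P₁ ≠ P₂ → P₂ ≠ P₃ → P₁ ≠ P₃ →
          ∃ ψ : G ≃* G, P₁.map ψ.toMonoidHom = P₂ ∧ P₂.map ψ.toMonoidHom = P₃ ∧
            P₃.map ψ.toMonoidHom = P₁ ∧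
            ∀ P : Subgroup G,
              (P.Normal ∧ M ≤ P ∧ P ≠ ⊤ ∧ ∀ Q : Subgroup G, Q.Normal → P ≤ Q → Q = P ∨ Q = ⊤) →
              P ≠ P₁ → P ≠ P₂ → P ≠ P₃ → P.map ψ.toMonoidHom = P) ∨
        {P : Subgroup G | P.Normal ∧ M ≤ P ∧ P ≠ ⊤ ∧
          ∀ Q : Subgroup G, Q.Normal → P ≤ Q → Q = P ∨ Q = ⊤}.ncard ≤ 2) →
      ∀ X Y : Fin 3 → Subgroup G, (∀ i, (X i).Normal) → (∀ i, (Y i).Normal) →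
      (∀ i, M ≤ X i) → (∀ i, M ≤ Y i) →
      (∀ i j : Fin 3, i ≠ j → ∃ α : G ≃* G,
        (X i).map α.toMonoidHom = Y i ∧ (X j).map α.toMonoidHom = Y j) →
      X 0 ⊔ X 1 ⊔ X 2 = ⊤ → Y 0 ⊔ Y 1 ⊔ Y 2 = ⊤ →
      ∃ ψ : G ≃* G, ∀ i : Fin 3, (X i).map ψ.toMonoidHom = Y i :=
  fun G _ M hM hMf hmaxc hnonab hmono X Y hXn hYn hMX hMY hpair hXcov hYcov =>
    gate_of_monodromy (G := G) M hM hMf hmaxc hnonab hmono X Y hXn hYn hMX hMY hpair hXcov hYcov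

end Summit.SmoothPoincare4.SmoothPoincare4.Theorems.ShadowsStandard.PrymLayerStableRank

end
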